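import Summits.ResolutionOfSingularities.ResolutionOfSingularities.Theorems.EquisingularLiftEquisingularLiftNatTowerPtRamInv
import Literature.AlgebraicGeometry.Resolution.BlowupsLocal
import HarnessLib

/-!
# [OURS · L1 W4.5(b) · EL♮(3)] Rung TOWER₂ — A POINT STEP WITH ANY CENTRE OVER ONE SPECIAL POINT ON THE TOWER INVARIANT `Tower.Inv₂`
# (res-D-pv-029 …NatTowerInvDefs v2, p556392): CENTRE-AGNOSTIC new-plane / transport / forget lemmas, shared by (pt-reg) and (pt-ram)
# (crux `EquisingularLiftNatThree` = stmt-ResolutionOfSingularities-20148, parent `EquisingularLiftNat` = stmt-…-20038; registered stub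
# `stub_elnat_coneTowerPointResolution`, upstairs debt HSUB′(ReachTower₂)₃; constructors `TowerPtReg₂` / `TowerPtRam₂`, …NatTowerReachTwoDefs)

HONEST FRAMING. OURS (cell res-hironaka, crux chain w45b, slot W4.5(b)); NOT a statement of any manuscript; AI-written, weaker than expert
review. Helper `--supports stmt-ResolutionOfSingularities-20148 --as helper`; closes nothing; no `sorry`; standard axioms; DEF-FREE.
res-L1-w45b-stub-4 (`towerPtRam_brick`), on res-D-pv-029 g8's ASKs 2026-08-27T18:33:04Z («re-target PART 3 to `Tower.Inv₂`: + (k-v)/(k-vi)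
along your (E1) iso») and 18:39:54Z («factor the transport half as a CENTRE-AGNOSTIC lemma»). This file is PART 3 (…NatTowerPtRamInv,
p555772) lifted to `Tower.Inv₂` with the stage and the centre turned into HYPOTHESES: the old stage `(X, σ, S, jG)` with its `Tower.Exc₂`,
a closed point `pt` with `T ⊄ {pt}`, ANY downstairs centre `D` supported at `pt` with its blow-up `υ₂`, ANY upstairs blow-up `τ` along a
centre `C` missing every closed subscheme not through `jG pt`, the model square `j₂ ≫ τ = υ₂ ≫ jG`, and the new `Ch`-stage facts — so the
(pt-ram) brick (…NatTowerPtRamInvTwo: `fatPointStep_model` supplies them) and res-D-pv-029's (pt-reg) brick (section + `modelPointStep_of_section`)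
both call it.

* `Tower.inv₂_pointCentre_new` — `Tower.Inv₂` at `(G′, υ₂ ≫ γ, closure υ₂⁻¹(T∖{pt}), υ₂⁻¹{pt}, K′)` for ANY `K′` (the new plane hosts no round).
* `Tower.inv₂_pointCentre_transport` — at `(…, closure υ₂⁻¹(E∖{pt}), closure υ₂⁻¹(K∖{pt}))` under «`NoRound ∨ pt ∉ E`», «`K = ∅ ∨ pt ∉ closure K`»
  and the `Ruled` transport hypothesis (interface `ruled_of_step_away`, adopted by res-D-pv-029 18:39:54Z): `𝓔, 𝒦 ↦ ·.comap τ` by part 1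
  (E1)–(E4); (k-iii) flatness and the NEW Cartier clauses (k-v)/(k-vi) through the isos `V((·).comap τ) ≅ V(·)` over `τ`
  (`IsEffectiveCartier.comap_of_isOpenImmersion`); (k-iv) by `Tower.shadow_conditionalRegularity_transport` (part 3).
* `Tower.inv₂_pointCentre_forget` — the same with the shadow forgotten.

References: Q. Liu (2002), §8.1, Thm. 8.1.19; U. Görtz, T. Wedhorn (2020), Prop. 13.91 (3), (13.19); The Stacks Project, Tags 02OS, 033B, 01WS — through the
cited tree files. OURS planning texts (index only): res-D-pv-029 STATUS 18:33:04Z, 18:39:54Z; res-L1-w45b-plan-1 18:27:13Z / res-L1-w45b-lead-2 18:31:42Z (RULING-6 text).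
-/

set_option linter.dupNamespace false -- mandated namespace `Summit.<Summit>.<Problem>` of this single-conjunct summit

noncomputable section

open CategoryTheory CategoryTheory.Limits AlgebraicGeometry TopologicalSpace Topology IsLocalRing
open Literature.AlgebraicGeometry.Resolution
open AlgebraicGeometry.Scheme.IdealSheafData
open Summit.ResolutionOfSingularities.ResolutionOfSingularities.Theses.EquisingularLift.Split

namespace Summit.ResolutionOfSingularities.ResolutionOfSingularities.Cruxes.EquisingularLiftNat.Sections

section PointCentre

variable (O : Type) [CommRing O] (k : Type) [Field k] (θ : O →+* k) (P : Scheme.{0}) (q : P ⟶ Spec (.of O)) (Y : Set P)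
  (Ch : ∀ X' : Scheme.{0}, (X' ⟶ P) → Set X' → Prop) (Ruled : Tower.RuledDatum P)
  {F₉ : Scheme.{0}} {Z₉ : Set F₉} {hZ₉ : IsClosed Z₉} {F₁₀ : Scheme.{0}} {υ' : F₁₀ ⟶ F₉}
  {G G' X X'' : Scheme.{0}} {γ : G ⟶ F₁₀} {T E K : Set G}
  -- context and downstairs bookkeeping of the old invariant
  (hυ' : IsBlowup υ' (vanishingIdeal (⟨Z₉, hZ₉⟩ : Closeds F₉))) (hZ₉inf : Z₉.Infinite)
  (hTirr : IsIrreducible T) (hEcl : IsClosed E) (hTE : ¬ T ⊆ E)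
  -- the old stage and its exceptional / shadow datum
  {σ : X ⟶ P} {jG : G ⟶ X}
  (hExc : ∀ hE : IsClosed E, Tower.Exc₂ O P q Y Ruled Z₉ hZ₉ υ' G γ E hE K X σ jG)
  -- the point, the downstairs centre and its blow-up
  {pt : G} (hyc : IsClosed ({pt} : Set G)) (hTy : ¬ T ⊆ {pt}) {D : G.IdealSheafData} (hD : (D.support : Set G) = {pt})
  {υ₂ : G' ⟶ G} (hυ₂ : IsBlowup υ₂ D) [IsLocallyNoetherian G] [IsLocallyNoetherian X] [IsLocallyNoetherian X'']
  -- the upstairs blow-up: any centre missing every closed subscheme not through `jG pt`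
  {τ : X'' ⟶ X} {C : X.IdealSheafData} (hτ : IsBlowup τ C)
  (hdisj : ∀ I : X.IdealSheafData, jG pt ∉ (I.support : Set X) → Disjoint (I.support : Set X) (C.support : Set X))
  -- the model square and the new stage
  {j₂ : G' ⟶ X''} {t₂ : G' ⟶ Spec (.of k)} (hcomm : j₂ ≫ τ = υ₂ ≫ jG)
  {S'' : Set X''} (hCh'' : Ch X'' (τ ≫ σ) S'') [IsIntegral X''] (hX''reg : Scheme.IsRegular X'') (hdom'' : IsDominant ((τ ≫ σ) ≫ q))
  (hsq₂ : IsPullback j₂ t₂ ((τ ≫ σ) ≫ q) (Spec.map (CommRingCat.ofHom θ)))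
  (hsets : j₂ '' closure (υ₂ ⁻¹' (T \ {pt})) = S'') [IsIntegral G'] (hT'irr : IsIrreducible (closure (υ₂ ⁻¹' (T \ {pt}))))

include hυ' hZ₉inf hyc hTy hD hυ₂ hCh'' hX''reg hdom'' hsq₂ hsets hT'irr

omit [IsLocallyNoetherian X] in
/-- **A point step on `Tower.Inv₂`, NEW PLANE `E ↦ υ₂⁻¹{pt}`** — for ANY new shadow `K′`: the new plane hosts no round (it lies over one point
of `F₉`), `T′ ⊄ υ₂⁻¹{pt}` because `T ⊄ {pt}`. Centre-agnostic. [cite: Liu2002, §8.1 and Thm. 8.1.19] [OURS · L1 W4.5b · towerPtRam_brick /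
shared with (pt-reg)] toward `stub_elnat_coneTowerPointResolution` (stmt-ResolutionOfSingularities-20148 / -20038); NOT a statement of the manuscript. -/
theorem Tower.inv₂_pointCentre_new (K' : Set G') :
    Tower.Inv₂ O k θ P q Y Ch Ruled F₉ Z₉ hZ₉ F₁₀ υ' G' (υ₂ ≫ γ) (closure (υ₂ ⁻¹' (T \ {pt}))) (υ₂ ⁻¹' {pt}) K' := by
  -- `T′ ⊄ υ₂⁻¹{pt}`: a point of `T` other than `pt` lifts
  have hTE' : ¬ closure (υ₂ ⁻¹' (T \ {pt})) ⊆ υ₂ ⁻¹' {pt} := by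
    obtain ⟨t, htT, htne⟩ := Set.not_subset.mp hTy
    have htJ : t ∉ (D.support : Set G) := by rw [hD]; exact htne
    obtain ⟨t₂, ht₂⟩ := exists_preimage_of_not_mem_support υ₂ D hυ₂ htJ
    intro hsub
    have h1 : t₂ ∈ closure (υ₂ ⁻¹' (T \ {pt})) := subset_closure (by rw [Set.mem_preimage, ht₂]; exact ⟨htT, htne⟩)
    have h2 := hsub h1
    rw [Set.mem_preimage, ht₂] at h2
    exact htne h2
  refine ⟨hυ', hZ₉inf, inferInstance, isClosed_closure, hT'irr, hyc.preimage υ₂.continuous, hTE', X'', τ ≫ σ, _, j₂, t₂, hCh'',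
    inferInstance, inferInstance, hX''reg, hdom'', hsq₂, hsets, fun _ => Or.inl ?_⟩
  refine (Set.finite_singleton ((γ ≫ υ') pt)).subset ?_
  rintro _ ⟨z, hz, rfl⟩
  rw [Set.mem_preimage, Set.mem_singleton_iff] at hz
  rw [Set.mem_singleton_iff, Scheme.Hom.comp_apply, Scheme.Hom.comp_apply, Scheme.Hom.comp_apply, hz]

include hTirr hEcl hTE hExc hdisj hcomm hτ in
/-- **A point step on `Tower.Inv₂`, TRANSPORTED SURFACE `E ↦ closure υ₂⁻¹(E∖{pt})`, SHADOW CARRIED `K ↦ closure υ₂⁻¹(K∖{pt})`** — under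
«`E` hosts no round ∨ `pt ∉ E`», «`K = ∅ ∨ pt ∉ closure K`» and the ruled-datum transport hypothesis `hRuled`: `𝓔, 𝒦 ↦ ·.comap τ` (the centre
misses both), the Cartier clauses (k-v)/(k-vi) and the flatness (k-iii) through the isomorphisms `V((·).comap τ) ≅ V(·)` over `τ`, (k-iv) through
the stalk isomorphisms. Centre-agnostic. [cite: GortzWedhorn2020, Prop. 13.91 (3) and (13.19)] [cite: StacksProject, Tag 033B] [OURS · L1 W4.5b ·
towerPtRam_brick / shared with (pt-reg)] toward `stub_elnat_coneTowerPointResolution`; NOT a statement of the manuscript. -/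
theorem Tower.inv₂_pointCentre_transport
    (hRuled : ∀ (G₀ G₀' : Scheme.{0}) (γ₀ : G₀ ⟶ F₁₀) (E₀ : Set G₀) (X₀ X₀'' : Scheme.{0}) (σ₀ : X₀ ⟶ P) (j₀ : G₀ ⟶ X₀)
        (j₀' : G₀' ⟶ X₀'') (t₀' : G₀' ⟶ Spec (.of k)) (𝓔₀ : X₀.IdealSheafData) (τ₀ : X₀'' ⟶ X₀) (υ₀ : G₀' ⟶ G₀) (y₀ : G₀),
      j₀' ≫ τ₀ = υ₀ ≫ j₀ → IsPullback j₀' t₀' ((τ₀ ≫ σ₀) ≫ q) (Spec.map (CommRingCat.ofHom θ)) → y₀ ∉ E₀ →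
      (∃ e : (𝓔₀.comap τ₀).subscheme ≅ 𝓔₀.subscheme, e.hom ≫ 𝓔₀.subschemeι = (𝓔₀.comap τ₀).subschemeι ≫ τ₀) →
      Ruled F₉ Z₉ hZ₉ F₁₀ υ' G₀ γ₀ E₀ X₀ σ₀ j₀ 𝓔₀ →
      Ruled F₉ Z₉ hZ₉ F₁₀ υ' G₀' (υ₀ ≫ γ₀) (closure (υ₀ ⁻¹' (E₀ \ {y₀}))) X₀'' (τ₀ ≫ σ₀) j₀' (𝓔₀.comap τ₀))
    (hE : Tower.NoRound υ' G γ E ∨ pt ∉ E) (hK : K = ∅ ∨ pt ∉ closure K) :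
    Tower.Inv₂ O k θ P q Y Ch Ruled F₉ Z₉ hZ₉ F₁₀ υ' G' (υ₂ ≫ γ) (closure (υ₂ ⁻¹' (T \ {pt})))
      (closure (υ₂ ⁻¹' (E \ {pt}))) (closure (υ₂ ⁻¹' (K \ {pt}))) := by
  -- `T′ ⊄ E′`: a point of `T` off `E` and other than `pt` lifts
  have hE'sub : closure (υ₂ ⁻¹' (E \ {pt})) ⊆ υ₂ ⁻¹' E :=
    closure_minimal (fun z hz => hz.1) (hEcl.preimage υ₂.continuous)
  have hTE' : ¬ closure (υ₂ ⁻¹' (T \ {pt})) ⊆ closure (υ₂ ⁻¹' (E \ {pt})) := by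
    have hex : ∃ t ∈ T, t ∉ E ∧ t ≠ pt := by
      by_contra hcon
      push Not at hcon
      have hsub : T ⊆ E ∪ {pt} := fun t ht => by
        by_cases h : t ∈ E
        · exact Or.inl h
        · exact Or.inr (hcon t ht h)
      rcases (isPreirreducible_iff_isClosed_union_isClosed.mp hTirr.isPreirreducible) _ _ hEcl hyc hsub with h | h
      · exact hTE h
      · exact hTy h
    obtain ⟨t, htT, htE, htne⟩ := hex
    have htJ : t ∉ (D.support : Set G) := by rw [hD]; exact htne
    obtain ⟨t₂, ht₂⟩ := exists_preimage_of_not_mem_support υ₂ D hυ₂ htJ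
    intro hsub
    have h1 : t₂ ∈ closure (υ₂ ⁻¹' (T \ {pt})) := subset_closure (by rw [Set.mem_preimage, ht₂]; exact ⟨htT, htne⟩)
    have h2 := hE'sub (hsub h1)
    rw [Set.mem_preimage, ht₂] at h2
    exact htE h2
  -- `NoRound` persists
  have hNR : Tower.NoRound υ' G γ E → Tower.NoRound υ' G' (υ₂ ≫ γ) (closure (υ₂ ⁻¹' (E \ {pt}))) := by
    intro hno
    refine hno.subset ?_
    rintro _ ⟨z, hz, rfl⟩
    exact ⟨υ₂ z, hE'sub hz, by rw [Scheme.Hom.comp_apply, Scheme.Hom.comp_apply, Scheme.Hom.comp_apply]⟩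
  refine ⟨hυ', hZ₉inf, inferInstance, isClosed_closure, hT'irr, isClosed_closure, hTE', X'', τ ≫ σ, _, j₂, t₂, hCh'',
    inferInstance, inferInstance, hX''reg, hdom'', hsq₂, hsets, fun hE' => ?_⟩
  rcases hE with hno | hyE
  · exact Or.inl (hNR hno)
  rcases hExc hEcl with hno | ⟨𝓔, he1, he2, he3, he4, he5, hSh⟩
  · exact Or.inl (hNR hno)
  -- the round-ready branch: transport `𝓔`
  have he1' : 𝓔.comap jG = vanishingIdeal (⟨closure E, isClosed_closure⟩ : Closeds G) := by
    rw [he1]; congr 1; exact Closeds.ext hEcl.closure_eq.symm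
  have hyE' : pt ∉ closure E := by rwa [hEcl.closure_eq]
  obtain ⟨hd𝓔, he, -, hregT, hprinc, htrace⟩ := fatPointStep_transport hτ hcomm hυ₂ hD hdisj 𝓔 E he1' hyE'
  obtain ⟨e𝓔, he𝓔⟩ := he
  refine Or.inr ⟨𝓔.comap τ, htrace, fun z => hprinc z (he2 (τ z)), hregT he3, ?_, ?_, ?_⟩
  · rintro _ ⟨z, hz, rfl⟩
    have hz' : τ z ∈ (𝓔.support : Set X) := by rw [support_comap] at hz; exact hz
    rw [Scheme.Hom.comp_apply]
    exact he4 ⟨τ z, hz', rfl⟩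
  · exact hRuled G G' γ E X X'' σ jG j₂ t₂ 𝓔 τ υ₂ pt hcomm hsq₂ hyE ⟨e𝓔, he𝓔⟩ he5
  · -- the cone shadow with the Cartier clauses
    rcases hK with hK0 | hyK
    · left
      rw [hK0, Set.empty_sdiff, Set.preimage_empty, closure_empty]
    rcases hSh with hK0 | ⟨𝒦, hk1, hk2, hk3, hk4, hk5, hk6⟩
    · left
      rw [hK0, Set.empty_sdiff, Set.preimage_empty, closure_empty]
    obtain ⟨hd𝒦, he', -, -, hprinc𝒦, htrace𝒦⟩ := fatPointStep_transport hτ hcomm hυ₂ hD hdisj 𝒦 K hk2 hyK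
    obtain ⟨e𝒦, he𝒦⟩ := he'
    have htrace𝒦' : (𝒦.comap τ).comap j₂ =
        vanishingIdeal (⟨closure (closure (υ₂ ⁻¹' (K \ {pt}))), isClosed_closure⟩ : Closeds G') := by
      rw [htrace𝒦]; congr 1; exact Closeds.ext closure_closure.symm
    refine Or.inr ⟨𝒦.comap τ, fun z => hprinc𝒦 z (hk1 (τ z)), htrace𝒦', ?_, ?_, ?_, ?_⟩
    · -- (k-iii) flatness through the iso over `τ`
      rw [← Scheme.IdealSheafData.comap_sup]
      have hdEK : Disjoint (((𝓔 ⊔ 𝒦).support : Set X)) (C.support : Set X) :=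
        hd𝒦.mono_left (Scheme.IdealSheafData.support_antitone (le_sup_right : 𝒦 ≤ 𝓔 ⊔ 𝒦))
      obtain ⟨e', he'⟩ := exists_iso_subscheme_comap_of_disjoint hτ (𝓔 ⊔ 𝒦) hdEK
      have hfac : ((𝓔 ⊔ 𝒦).comap τ).subschemeι ≫ (τ ≫ σ) ≫ q = e'.hom ≫ ((𝓔 ⊔ 𝒦).subschemeι ≫ σ ≫ q) := by
        rw [← Category.assoc e'.hom, he', Category.assoc, Category.assoc]
      rw [hfac]
      haveI := hk3
      infer_instance
    · -- (k-iv) conditional regularity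
      exact Tower.shadow_conditionalRegularity_transport hτ hcomm hυ₂ hD 𝓔 𝒦 hd𝓔 hd𝒦 hEcl hyE hyK hk2 hk4 hE'
    · -- (k-v) `E` cuts a Cartier divisor on the cone, through `V(𝒦.comap τ) ≅ V(𝒦)`
      have h1 : (𝓔.comap τ).comap (𝒦.comap τ).subschemeι = (𝓔.comap 𝒦.subschemeι).comap e𝒦.hom := by
        rw [← Scheme.IdealSheafData.comap_comp, ← Scheme.IdealSheafData.comap_comp, he𝒦]
      rw [h1]
      exact hk5.comap_of_isOpenImmersion e𝒦.hom
    · -- (k-vi) the cone cuts a Cartier divisor on `V(𝓔)`, through `V(𝓔.comap τ) ≅ V(𝓔)`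
      have h1 : (𝒦.comap τ).comap (𝓔.comap τ).subschemeι = (𝒦.comap 𝓔.subschemeι).comap e𝓔.hom := by
        rw [← Scheme.IdealSheafData.comap_comp, ← Scheme.IdealSheafData.comap_comp, he𝓔]
      rw [h1]
      exact hk6.comap_of_isOpenImmersion e𝓔.hom

include hTirr hEcl hTE hExc hdisj hcomm hτ in
/-- **A point step on `Tower.Inv₂`, TRANSPORTED SURFACE, SHADOW FORGOTTEN** (`K ↦ ∅`, RULING-5 γ-forget). [cite: GortzWedhorn2020, Prop. 13.91 (3)]
[OURS · L1 W4.5b · towerPtRam_brick / shared with (pt-reg)] toward `stub_elnat_coneTowerPointResolution`; NOT a statement of the manuscript. -/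
theorem Tower.inv₂_pointCentre_forget
    (hRuled : ∀ (G₀ G₀' : Scheme.{0}) (γ₀ : G₀ ⟶ F₁₀) (E₀ : Set G₀) (X₀ X₀'' : Scheme.{0}) (σ₀ : X₀ ⟶ P) (j₀ : G₀ ⟶ X₀)
        (j₀' : G₀' ⟶ X₀'') (t₀' : G₀' ⟶ Spec (.of k)) (𝓔₀ : X₀.IdealSheafData) (τ₀ : X₀'' ⟶ X₀) (υ₀ : G₀' ⟶ G₀) (y₀ : G₀),
      j₀' ≫ τ₀ = υ₀ ≫ j₀ → IsPullback j₀' t₀' ((τ₀ ≫ σ₀) ≫ q) (Spec.map (CommRingCat.ofHom θ)) → y₀ ∉ E₀ →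
      (∃ e : (𝓔₀.comap τ₀).subscheme ≅ 𝓔₀.subscheme, e.hom ≫ 𝓔₀.subschemeι = (𝓔₀.comap τ₀).subschemeι ≫ τ₀) →
      Ruled F₉ Z₉ hZ₉ F₁₀ υ' G₀ γ₀ E₀ X₀ σ₀ j₀ 𝓔₀ →
      Ruled F₉ Z₉ hZ₉ F₁₀ υ' G₀' (υ₀ ≫ γ₀) (closure (υ₀ ⁻¹' (E₀ \ {y₀}))) X₀'' (τ₀ ≫ σ₀) j₀' (𝓔₀.comap τ₀))
    (hE : Tower.NoRound υ' G γ E ∨ pt ∉ E) :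
    Tower.Inv₂ O k θ P q Y Ch Ruled F₉ Z₉ hZ₉ F₁₀ υ' G' (υ₂ ≫ γ) (closure (υ₂ ⁻¹' (T \ {pt})))
      (closure (υ₂ ⁻¹' (E \ {pt}))) ∅ := by
  -- forget the shadow in the old datum, then transport with `K := ∅`
  have hExc' : ∀ hE : IsClosed E, Tower.Exc₂ O P q Y Ruled Z₉ hZ₉ υ' G γ E hE (∅ : Set G) X σ jG := by
    intro hE'
    rcases hExc hE' with hno | ⟨𝓔, he1, he2, he3, he4, he5, -⟩
    · exact Or.inl hno
    · exact Or.inr ⟨𝓔, he1, he2, he3, he4, he5, Or.inl rfl⟩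
  have h := Tower.inv₂_pointCentre_transport O k θ P q Y Ch Ruled hυ' hZ₉inf hTirr hEcl hTE hExc' hyc hTy hD hυ₂ hτ hdisj hcomm
    hCh'' hX''reg hdom'' hsq₂ hsets hT'irr hRuled hE (Or.inl rfl)
  simpa only [Set.empty_sdiff, Set.preimage_empty, closure_empty] using h

end PointCentre

end Summit.ResolutionOfSingularities.ResolutionOfSingularities.Cruxes.EquisingularLiftNat.Sections

end
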